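import Mathlib
import HarnessLib
import Summits.AtomisticToContinuum.FouriersLaw.Theorems.JunctionLocalityNonBallisticContactCurrentFourthMoment
import Summits.AtomisticToContinuum.FouriersLaw.Theorems.OddSectorIrreversibilityOddCorrectorDecayOneSite
import Summits.AtomisticToContinuum.FouriersLaw.Theorems.PhononMeanFreePathIncoherentChannelCommonPastBoundHelper1

/-!
# Short-time dipole floor, helper 8: factorial-growth Gibbs moments, `N`-uniform (statics of the annealed light cone)

Helper (`--supports stmt-AtomisticToContinuum-11749`) for stub `stub_shortTimeDipoleFloor` (S) of line
`kick-dipole-no-collapse`, crux `JunctionLocality.ConductanceLowerBound`.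

The annealed (Gibbs ⊗ Wiener) light cone pairs the `n`-th order term `t^n/n!` of the lattice Gronwall series with the `n`-th
power of LOCAL random coefficients, so it needs the even moments of ONE position and ONE momentum under the Gibbs state
`μ_T^N` of the pinned anharmonic chain with at most factorial growth and constants independent of `N` and of the site:

* `helper_kdGibbsFactorialMoments` — `∃ C A, ∀ N i k: ∫ q_i^{2k} dμ_T^N ≤ C (A k)^k` and `∫ p_i^{2k} dμ_T^N ≤ C (A k)^k`.
  Momenta are exactly Gaussian (`commonPastBound_gibbsEvenMoments`: `T^k (2k−1)!! ≤ (2Tk)^k`); positions by the site-uniform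
  one-site domination `ChainVariation.pinnedChain_lintegral_coord_gibbsWeight_le` (transfer to `μ_T` by
  `NonBallistic.pinnedChain_integrable_and_integral_le_of_lintegral`) and the one-dimensional bound
  `∫ a^{2k} e^{−U(a)/T} da ≤ k! (4T/ω₂)^k ∫ e^{−ω₂a²/(4T)} da` (`U ≥ ω₂a²/2`, `x^k/k! ≤ e^x`).
* two elementary inequalities used downstream: the power mean `(Σ_{i∈s} z_i)^n ≤ |s|^n Σ z_i^n`,
  `pow_sum_le_card_pow_mul_sum_pow` (nonempty `s`), and Jensen in time `(∫₀ᵗ f)^n ≤ t^{n−1} ∫₀ᵗ f^n` (`pow_intervalIntegral_le`).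
-/

noncomputable section

open MeasureTheory Set Filter Topology Finset
open scoped ENNReal NNReal BigOperators

namespace Summit.AtomisticToContinuum.FouriersLaw.Cruxes.ConductanceLowerBound.KickDipoleNoCollapse

open Literature.MathematicalPhysics.KineticTheory.HeatConduction
open Summit.AtomisticToContinuum.FouriersLaw.Theorems

/-! ### Two elementary inequalities -/

/-- Power mean: `(Σ_{i∈s} z_i)^n ≤ |s|^n · Σ_{i∈s} z_i^n` for nonnegative `z` (a crude form of convexity of `x ↦ x^n`). -/
theorem pow_sum_le_card_pow_mul_sum_pow {ι : Type*} {s : Finset ι} (hne : s.Nonempty) {z : ι → ℝ}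
    (hz : ∀ i ∈ s, 0 ≤ z i) (n : ℕ) :
    (∑ i ∈ s, z i) ^ n ≤ (s.card : ℝ) ^ n * ∑ i ∈ s, z i ^ n := by
  have hc : (0 : ℝ) < s.card := by exact_mod_cast hne.card_pos
  have hmean := Real.pow_arith_mean_le_arith_mean_pow s (fun _ => (s.card : ℝ)⁻¹) z (fun _ _ => by positivity)
    (by rw [Finset.sum_const, nsmul_eq_mul, mul_inv_cancel₀ hc.ne']) hz n
  rw [← Finset.mul_sum, ← Finset.mul_sum, mul_pow, inv_pow] at hmean
  have hcn : (0 : ℝ) < (s.card : ℝ) ^ n := pow_pos hc n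
  rw [inv_mul_le_iff₀ hcn] at hmean
  calc (∑ i ∈ s, z i) ^ n ≤ (s.card : ℝ) ^ n * ((s.card : ℝ)⁻¹ * ∑ i ∈ s, z i ^ n) := hmean
    _ ≤ (s.card : ℝ) ^ n * ∑ i ∈ s, z i ^ n := by
        refine mul_le_mul_of_nonneg_left ?_ hcn.le
        have hS : 0 ≤ ∑ i ∈ s, z i ^ n := Finset.sum_nonneg fun i hi => pow_nonneg (hz i hi) n
        have h1 : (s.card : ℝ)⁻¹ ≤ 1 := inv_le_one_of_one_le₀ (by exact_mod_cast hne.card_pos)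
        nlinarith

/-- **Jensen in time**: `(∫₀ᵗ f)^n ≤ t^{n−1} ∫₀ᵗ f^n` for a continuous `f ≥ 0` on `[0, t]`, `t ≥ 0`, `n ≥ 1`. -/
theorem pow_intervalIntegral_le {f : ℝ → ℝ} (hf : Continuous f) (hf0 : ∀ s, 0 ≤ f s) {t : ℝ} (ht : 0 ≤ t) {n : ℕ}
    (hn : 1 ≤ n) : (∫ s in (0:ℝ)..t, f s) ^ n ≤ t ^ (n - 1) * ∫ s in (0:ℝ)..t, f s ^ n := by
  rcases ht.eq_or_lt with rfl | htpos
  · simp [zero_pow (by omega : n ≠ 0)]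
  have hconv : ConvexOn ℝ (Set.Ici (0:ℝ)) (fun x : ℝ => x ^ n) := convexOn_pow n
  have hvol : (volume : Measure ℝ) (Set.Ioc 0 t) ≠ 0 := by
    rw [Real.volume_Ioc]; simp [htpos]
  have hvol' : (volume : Measure ℝ) (Set.Ioc 0 t) ≠ ⊤ := by rw [Real.volume_Ioc]; simp
  have hJ := hconv.map_set_average_le (continuousOn_pow n) isClosed_Ici hvol hvol'
    (ae_of_all _ fun s => hf0 s) (hf.integrableOn_Ioc) ((hf.pow n).integrableOn_Ioc)
  -- unfold the averages
  rw [MeasureTheory.setAverage_eq, MeasureTheory.setAverage_eq] at hJ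
  simp only [smul_eq_mul, Measure.real, Real.volume_Ioc, sub_zero, ENNReal.toReal_ofReal ht] at hJ
  rw [intervalIntegral.integral_of_le ht, intervalIntegral.integral_of_le ht]
  rw [mul_pow, inv_pow] at hJ
  have htn : 0 < t ^ n := pow_pos htpos n
  have key : (∫ x in Set.Ioc 0 t, f x) ^ n ≤ t ^ n * (t⁻¹ * ∫ x in Set.Ioc 0 t, f x ^ n) := by
    rw [← inv_mul_le_iff₀ htn]; exact hJ
  calc (∫ x in Set.Ioc 0 t, f x) ^ n ≤ t ^ n * (t⁻¹ * ∫ x in Set.Ioc 0 t, f x ^ n) := key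
    _ = t ^ (n - 1) * ∫ x in Set.Ioc 0 t, f x ^ n := by
        obtain ⟨m, rfl⟩ : ∃ m, n = m + 1 := ⟨n - 1, by omega⟩
        rw [Nat.add_sub_cancel, pow_succ]
        field_simp

/-! ### The one-dimensional position weight -/

/-- Even powers are nonnegative. -/
theorem pow_nonneg' (a : ℝ) (k : ℕ) : 0 ≤ a ^ (2 * k) := by rw [pow_mul]; positivity

/-- `a^{2k} e^{−U(a)/T} ≤ k! (4T/ω₂)^k e^{−ω₂a²/(4T)}` for the pinned one-site potential `U(a) = ω₂a²/2 + lam a⁴/4`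
(`ω₂ > 0`, `lam ≥ 0`, `T > 0`): `x^k/k! ≤ e^x` at `x = ω₂a²/(4T)`. -/
theorem pow_mul_exp_neg_U_le {ω₂ lam T : ℝ} (hω : 0 < ω₂) (hl : 0 ≤ lam) (hT : 0 < T) (β γ a : ℝ) (k : ℕ) :
    a ^ (2 * k) * Real.exp (-(pinnedChain ω₂ lam β γ).U a / T) ≤
      (k.factorial * (4 * T / ω₂) ^ k) * Real.exp (-(ω₂ / (4 * T)) * a ^ 2) := by
  have hU : ω₂ * a ^ 2 / 2 ≤ (pinnedChain ω₂ lam β γ).U a := by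
    show ω₂ * a ^ 2 / 2 ≤ ω₂ * a ^ 2 / 2 + lam * a ^ 4 / 4
    have : 0 ≤ lam * a ^ 4 / 4 := by positivity
    linarith
  set x : ℝ := ω₂ / (4 * T) * a ^ 2 with hx
  have hx0 : 0 ≤ x := by positivity
  have h1 : x ^ k ≤ k.factorial * Real.exp x := by
    have h := Real.pow_div_factorial_le_exp x hx0 k
    rwa [div_le_iff₀ (by positivity), mul_comm] at h
  have h2 : a ^ (2 * k) = (4 * T / ω₂) ^ k * x ^ k := by
    rw [hx, ← mul_pow, pow_mul]
    congr 1
    field_simp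
  have h3 : Real.exp (-(pinnedChain ω₂ lam β γ).U a / T) ≤ Real.exp (-(2 * x)) := by
    refine Real.exp_le_exp.2 ?_
    rw [hx, neg_div, neg_le_neg_iff, le_div_iff₀ hT]
    calc 2 * (ω₂ / (4 * T) * a ^ 2) * T = ω₂ * a ^ 2 / 2 := by field_simp; ring
      _ ≤ _ := hU
  calc a ^ (2 * k) * Real.exp (-(pinnedChain ω₂ lam β γ).U a / T)
      ≤ ((4 * T / ω₂) ^ k * x ^ k) * Real.exp (-(2 * x)) := by
        rw [h2]; exact mul_le_mul_of_nonneg_left h3 (by positivity)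
    _ ≤ ((4 * T / ω₂) ^ k * (k.factorial * Real.exp x)) * Real.exp (-(2 * x)) := by
        gcongr
    _ = (k.factorial * (4 * T / ω₂) ^ k) * Real.exp (-(ω₂ / (4 * T)) * a ^ 2) := by
        rw [show -(ω₂ / (4 * T)) * a ^ 2 = x + -(2 * x) by rw [hx]; ring, Real.exp_add]
        ring

/-- The one-dimensional position weight has at most factorial moments:
`∫⁻ a^{2k} e^{−U/T} ≤ k! (4T/ω₂)^k ∫ e^{−ω₂a²/(4T)} da` (as an `ℝ≥0∞` bound with a finite right side). -/
theorem lintegral_pow_mul_exp_neg_U_le {ω₂ lam T : ℝ} (hω : 0 < ω₂) (hl : 0 ≤ lam) (hT : 0 < T) (β γ : ℝ) (k : ℕ) :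
    ∫⁻ a, ENNReal.ofReal (a ^ (2 * k)) * ENNReal.ofReal (Real.exp (-(pinnedChain ω₂ lam β γ).U a / T)) ≤
      ENNReal.ofReal ((k.factorial * (4 * T / ω₂) ^ k) * Real.sqrt (Real.pi / (ω₂ / (4 * T)))) := by
  have hb : 0 < ω₂ / (4 * T) := by positivity
  have hG : ∫ a, Real.exp (-(ω₂ / (4 * T)) * a ^ 2) = Real.sqrt (Real.pi / (ω₂ / (4 * T))) := integral_gaussian _
  have hGi : Integrable fun a => Real.exp (-(ω₂ / (4 * T)) * a ^ 2) := integrable_exp_neg_mul_sq hb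
  calc ∫⁻ a, ENNReal.ofReal (a ^ (2 * k)) * ENNReal.ofReal (Real.exp (-(pinnedChain ω₂ lam β γ).U a / T))
      = ∫⁻ a, ENNReal.ofReal (a ^ (2 * k) * Real.exp (-(pinnedChain ω₂ lam β γ).U a / T)) := by
        refine lintegral_congr fun a => ?_
        rw [ENNReal.ofReal_mul (pow_nonneg' a k)]
    _ ≤ ∫⁻ a, ENNReal.ofReal ((k.factorial * (4 * T / ω₂) ^ k) * Real.exp (-(ω₂ / (4 * T)) * a ^ 2)) :=
        lintegral_mono fun a => ENNReal.ofReal_le_ofReal (pow_mul_exp_neg_U_le hω hl hT β γ a k)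
    _ = ENNReal.ofReal ((k.factorial * (4 * T / ω₂) ^ k) * Real.sqrt (Real.pi / (ω₂ / (4 * T)))) := by
        rw [← hG, ← integral_const_mul, ofReal_integral_eq_lintegral_ofReal (hGi.const_mul _)
          (ae_of_all _ fun a => by positivity)]

/-! ### `N`-uniform factorial moments of one position and one momentum -/

/-- **Registered helper `helper_kdGibbsFactorialMoments` (stub S, line `kick-dipole-no-collapse`): `N`-UNIFORM GIBBS MOMENTS
WITH FACTORIAL GROWTH.**  For the pinned anharmonic chain (`ω₂ > 0`, `lam, β ≥ 0`) and `T > 0` there are `C ≥ 1`, `A > 0` such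
that for EVERY `N`, EVERY site `i` and EVERY order `k`: `q_i^{2k}, p_i^{2k} ∈ L¹(μ_T^N)`, `∫ q_i^{2k} dμ_T^N ≤ C (A k)^k` and
`∫ p_i^{2k} dμ_T^N ≤ C (A k)^k` (Gaussian momenta; site-uniform one-site domination for the positions). -/
theorem helper_kdGibbsFactorialMoments : ∀ ω₂ lam β γ : ℝ, 0 < ω₂ → 0 ≤ lam → 0 ≤ β → ∀ T : ℝ, 0 < T → ∃ C A : ℝ, 1 ≤ C ∧ 0 < A ∧ ∀ (N : ℕ) (i : Fin N) (k : ℕ), Integrable (fun x : PhaseSpace N => x.1 i ^ (2 * k)) ((pinnedChain ω₂ lam β γ).gibbsMeasure N T) ∧ ∫ x, x.1 i ^ (2 * k) ∂((pinnedChain ω₂ lam β γ).gibbsMeasure N T) ≤ C * (A * k) ^ k ∧ Integrable (fun x : PhaseSpace N => x.2 i ^ (2 * k)) ((pinnedChain ω₂ lam β γ).gibbsMeasure N T) ∧ ∫ x, x.2 i ^ (2 * k) ∂((pinnedChain ω₂ lam β γ).gibbsMeasure N T) ≤ C * (A * k) ^ k := by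
  intro ω₂ lam β γ hω hl hβ T hT
  set P := pinnedChain ω₂ lam β γ with hP
  -- the one-dimensional constants
  set B : ℝ≥0∞ := ∫⁻ a, ENNReal.ofReal (Real.exp (-P.U a / T)) with hB
  have hBtop : B ≠ ⊤ := SubdiffusiveBondHeat.pinnedChain_lintegral_exp_neg_U_ne_top (β := β) hω hl γ hT
  have hB0 : B ≠ 0 := SubdiffusiveBondHeat.pinnedChain_lintegral_exp_neg_U_ne_zero ω₂ lam β γ T
  have hBpos : 0 < B.toReal := ENNReal.toReal_pos hB0 hBtop
  set G : ℝ := Real.sqrt (Real.pi / (ω₂ / (4 * T))) with hG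
  have hG0 : 0 ≤ G := Real.sqrt_nonneg _
  set C : ℝ := max 1 (G / B.toReal) with hC
  set A : ℝ := max (2 * T) (4 * T / ω₂) with hA
  have hC1 : 1 ≤ C := le_max_left _ _
  have hA0 : 0 < A := lt_max_of_lt_left (by positivity)
  refine ⟨C, A, hC1, hA0, fun N i k => ?_⟩
  rcases Nat.eq_zero_or_pos N with hN | hN
  · subst hN; exact i.elim0
  have hpos : Integrable (fun x : PhaseSpace N => x.1 i ^ (2 * k)) (P.gibbsMeasure N T) ∧
      ∫ x, x.1 i ^ (2 * k) ∂(P.gibbsMeasure N T) ≤ C * (A * k) ^ k := by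
    haveI : IsProbabilityMeasure (P.gibbsMeasure N T) := pinnedChain_isProbabilityMeasure_gibbsMeasure hω hl hβ γ N hT
    have hdom := ChainVariation.pinnedChain_lintegral_coord_gibbsWeight_le hω hl hβ γ hT i
      (h := fun a => ENNReal.ofReal (a ^ (2 * k))) (by fun_prop) (PhononMeanFreePath.lightCone_radMono_ofReal_pow_even k)
    have h1d := lintegral_pow_mul_exp_neg_U_le hω hl hT β γ k
    set A' : ℝ≥0∞ := ENNReal.ofReal ((k.factorial * (4 * T / ω₂) ^ k) * G) with hA'
    have key : (∫⁻ z : PhaseSpace N, ENNReal.ofReal (z.1 i ^ (2 * k) * P.gibbsDensity N T z)) * B ≤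
        A' * ∫⁻ z : PhaseSpace N, ENNReal.ofReal (P.gibbsDensity N T z) := by
      have e1 : ∀ z : PhaseSpace N, ENNReal.ofReal (z.1 i ^ (2 * k) * P.gibbsDensity N T z) =
          ENNReal.ofReal (z.1 i ^ (2 * k)) * ENNReal.ofReal (Real.exp (-P.hamiltonian N z / T)) := fun z => by
        rw [ENNReal.ofReal_mul (pow_nonneg' _ _)]; rfl
      have e2 : ∀ z : PhaseSpace N, ENNReal.ofReal (P.gibbsDensity N T z) = ENNReal.ofReal (Real.exp (-P.hamiltonian N z / T)) :=
        fun z => rfl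
      simp_rw [e1, e2]
      exact hdom.trans (mul_le_mul' h1d le_rfl)
    obtain ⟨hint, hle⟩ := NonBallistic.pinnedChain_integrable_and_integral_le_of_lintegral hω hl hβ γ hT
      (F := fun z : PhaseSpace N => z.1 i ^ (2 * k)) (by fun_prop) (fun z => pow_nonneg' _ _) (by simp [hA'])
      hB0 hBtop key
    refine ⟨hint, hle.trans ?_⟩
    rw [hA', ENNReal.toReal_ofReal (by positivity)]
    have hk : (k.factorial : ℝ) ≤ (k : ℝ) ^ k := by exact_mod_cast Nat.factorial_le_pow k
    calc (k.factorial * (4 * T / ω₂) ^ k) * G / B.toReal = (G / B.toReal) * (k.factorial * (4 * T / ω₂) ^ k) := by ring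
      _ ≤ C * ((k : ℝ) ^ k * (4 * T / ω₂) ^ k) := by
          refine mul_le_mul (le_max_right _ _) (mul_le_mul_of_nonneg_right hk (by positivity)) (by positivity)
            (zero_le_one.trans hC1)
      _ = C * ((4 * T / ω₂) * k) ^ k := by rw [mul_pow]; ring
      _ ≤ C * (A * k) ^ k := by
          refine mul_le_mul_of_nonneg_left (pow_le_pow_left₀ (by positivity) ?_ k) (zero_le_one.trans hC1)
          exact mul_le_mul_of_nonneg_right (le_max_right _ _) (Nat.cast_nonneg k)
  refine ⟨hpos.1, hpos.2, (PhononMeanFreePath.commonPastBound_gibbsEvenMoments ω₂ lam β γ hω hl hβ T hT N i k).1, ?_⟩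
  · obtain ⟨-, hval⟩ := PhononMeanFreePath.commonPastBound_gibbsEvenMoments ω₂ lam β γ hω hl hβ T hT N i k
    rw [hval]
    have hprod : ∏ j ∈ Finset.range k, (2 * (j : ℝ) + 1) ≤ (2 * (k : ℝ)) ^ k := by
      calc ∏ j ∈ Finset.range k, (2 * (j : ℝ) + 1) ≤ ∏ _j ∈ Finset.range k, (2 * (k : ℝ)) := by
            refine Finset.prod_le_prod (fun j _ => by positivity) fun j hj => ?_
            have : (j : ℝ) + 1 ≤ k := by exact_mod_cast Finset.mem_range.1 hj
            linarith
        _ = (2 * (k : ℝ)) ^ k := by simp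
    calc T ^ k * ∏ j ∈ Finset.range k, (2 * (j : ℝ) + 1) ≤ T ^ k * (2 * (k : ℝ)) ^ k :=
          mul_le_mul_of_nonneg_left hprod (by positivity)
      _ = 1 * ((2 * T) * k) ^ k := by rw [mul_pow, mul_pow, mul_pow]; ring
      _ ≤ C * (A * k) ^ k := by
          refine mul_le_mul hC1 (pow_le_pow_left₀ (by positivity) ?_ k) (by positivity) (zero_le_one.trans hC1)
          exact mul_le_mul_of_nonneg_right (le_max_left _ _) (Nat.cast_nonneg k)

end Summit.AtomisticToContinuum.FouriersLaw.Cruxes.ConductanceLowerBound.KickDipoleNoCollapse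

end
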